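import Mathlib.MeasureTheory.Integral.IntervalIntegral.FundThmCalculus
import Mathlib.MeasureTheory.Integral.DominatedConvergence
import Mathlib.Analysis.Normed.Group.FunctionSeries
import Mathlib.Analysis.SpecialFunctions.Integrals.Basic
import Mathlib.Analysis.SpecificLimits.Normed
import Literature.MathematicalPhysics.KineticTheory.LinearLorentzBoltzmann
import HarnessLib

/-!
# The collision series solves the linear Lorentz–Boltzmann equation (discharge of F1)
(trunk T-KINETIC; topic MathematicalPhysics/KineticTheory; proofs for
`Literature.MathematicalPhysics.KineticTheory.LinearLorentzBoltzmann`)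

This file discharges the named fact `Kinetic.lorentzSeries_isMildSolution` of
`LinearLorentzBoltzmann`: for `σ ≥ 0` and continuous bounded data `f₀ ≥ 0` on `ℝ^d × ℝ^d`, the
collision (Duhamel, Dyson) series `f = ∑ₙ uₙ = Kinetic.lorentzSeriesSolution (Euclidean.geometry d) σ f₀`
is, for every `T ≥ 0`, a mild solution on `[0, T]` of `∂ₜ f + v·∇ₓ f = σ L f`
(`Kinetic.IsMildLinearLorentzSolutionOn`), `L = Kinetic.lorentzCollisionOp` — the analytic
(semigroup) half of the Gallavotti–Spohn theorem (Spohn, Comm. Math. Phys. 60 (1978) §3, the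
Dyson expansion of the limiting semigroup in the proof of Thm 2, and Thm 3, (4.2), the generator
of the random flight process; Gallavotti 1972). Main result:
`Kinetic.lorentzSeries_isMildSolution_holds`.

## Proof

Routine Picard/Dyson estimates, all elementary:

* `Kinetic.abs_lorentzSeriesTerm_le`: the factorial bound
  `|uₙ(t, x, v)| ≤ M e^{a(v)T} (a(v) e^{a(v)T})ⁿ |t|ⁿ / n!`, `a(v) = σ |S^{d-1}| |v|`, for
  `|f₀| ≤ M`, `|t| ≤ T` (each collision costs `σ ∫ (v·ω)₊ dω ≤ a(v)`, the jumps `v ↦ v - 2(v·ω)ω`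
  preserve the speed, ordered time integrals give `|t|ⁿ/n!`); `Kinetic.continuous_lorentzSeriesTerm`:
  joint continuity of `uₙ` (parametric integrals of continuous kernels over the compact sphere and
  over `[0, t]`).
* `Kinetic.summable_lorentzSeriesTerm`, `Kinetic.continuous_lorentzSeriesSolution`: absolute
  convergence, locally uniform in `(t, x, v)`, hence continuity of `f`.
* `Kinetic.lorentzSeriesSolution_eq_gainLoss`: summing the recursion (dominated convergence in the
  time integral and in the gain operator) gives the gain/loss Duhamel formula
  `f(t, x, v) = e^{-σν(v)t} f₀(x - tv, v) + ∫₀ᵗ e^{-σν(v)(t-s)} σ (L⁺ f(s, x - (t-s)v, ·))(v) ds`.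
* `Kinetic.hasDerivAt_alongFlow_lorentzSeriesSolution`, `Kinetic.lorentzSeriesSolution_duhamel`:
  along characteristics `g(t) = f(t, x + tv, v) = e^{-λt}(f₀(x, v) + ∫₀ᵗ e^{λs} H(s) ds)` is
  differentiable with `g' = H - λ g`, `H(s) = σ (L⁺ f(s, x + sv, ·))(v)`, `λ = σ ν(v)`; the
  fundamental theorem of calculus and the splitting `L = L⁺ - ν`
  (`Kinetic.lorentzCollisionOp_eq_gain_sub_loss`) give Duhamel's formula
  `f♯(t) = f₀ + ∫₀ᵗ (σ L f)♯`, i.e. `Kinetic.IsMildLinearLorentzSolutionOn`.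

## Remarks

* `Kinetic.sphereMass E` (the real total mass `|S^{d-1}|` of `Hilbert6.sphereMeasure`, defined in
  `LinearLorentzBoltzmann`) is definitionally equal to `Literature.NS.unitSphereArea E` of
  `Literature.Analysis.FluidPDE.NormalisedPressure` (both are `volume.toSphere.real univ`); the
  NS file is not imported here to keep the kinetic trunk independent (review note on p7981).

## References

* H. Spohn, *The Lorentz process converges to a random flight process*, Comm. Math. Phys. 60
  (1978) 277–290, §3 (proof of Thm 2) and Thm 3, (4.2).
* G. Gallavotti, *Rigorous theory of the Boltzmann equation in the Lorentz gas*, Nota interna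
  358, Istituto di Fisica, Roma (1972); *Statistical Mechanics. A short treatise*, Springer (1999).
-/

open MeasureTheory Metric Real Set Filter Topology
open scoped InnerProductSpace ENNReal Nat Interval

namespace Literature.MathematicalPhysics.KineticTheory

noncomputable section

section Kinetic

/-! ## Sphere-integral estimates for the gain operator and the loss frequency -/

section SphereLemmas

variable {E : Type*} [NormedAddCommGroup E] [InnerProductSpace ℝ E] [FiniteDimensional ℝ E]
  [MeasurableSpace E] [BorelSpace E]

omit [FiniteDimensional ℝ E] [MeasurableSpace E] [BorelSpace E] in
/-- The hard-sphere kernel is bounded by the speed: `|(v·ω)₊| ≤ |v|` for `ω ∈ S^{d-1}`.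
[folklore] -/
theorem abs_max_inner_zero_le (v : E) (ω : sphere (0 : E) 1) : |max ⟪v, (ω : E)⟫_ℝ 0| ≤ ‖v‖ := by
  rw [abs_of_nonneg (le_max_right _ _)]
  refine max_le ?_ (norm_nonneg _)
  calc ⟪v, (ω : E)⟫_ℝ ≤ ‖v‖ * ‖(ω : E)‖ := real_inner_le_norm _ _
    _ = ‖v‖ := by rw [norm_eq_of_mem_sphere ω, mul_one]

omit [FiniteDimensional ℝ E] [MeasurableSpace E] [BorelSpace E] in
/-- Joint continuity of the hard-sphere kernel `(v, ω) ↦ (v·ω)₊`. [folklore] -/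
theorem continuous_max_inner_zero :
    Continuous fun p : E × sphere (0 : E) 1 => max ⟪p.1, (p.2 : E)⟫_ℝ 0 :=
  (continuous_fst.inner (continuous_subtype_val.comp continuous_snd)).max continuous_const

omit [FiniteDimensional ℝ E] [MeasurableSpace E] [BorelSpace E] in
/-- Joint continuity of the reflected velocity `(v, ω) ↦ v - 2(v·ω)ω`. [folklore] -/
theorem continuous_reflect_velocity :
    Continuous fun p : E × sphere (0 : E) 1 => p.1 - (2 * ⟪p.1, (p.2 : E)⟫_ℝ) • (p.2 : E) :=
  continuous_fst.sub ((continuous_const.mul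
    (continuous_fst.inner (continuous_subtype_val.comp continuous_snd))).smul
      (continuous_subtype_val.comp continuous_snd))

/-- The loss frequency is at most `|S^{d-1}| |v|`. [folklore] -/
theorem lorentzLossRate_le (v : E) : lorentzLossRate v ≤ sphereMass E * ‖v‖ := by
  have h : ∀ᵐ ω : sphere (0 : E) 1 ∂KineticTheory.sphereMeasure, ‖max ⟪v, (ω : E)⟫_ℝ 0‖ ≤ ‖v‖ :=
    Eventually.of_forall fun ω => by rw [Real.norm_eq_abs]; exact abs_max_inner_zero_le v ω
  have := norm_integral_le_of_norm_le_const h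
  rw [Real.norm_eq_abs] at this
  calc lorentzLossRate v ≤ |lorentzLossRate v| := le_abs_self _
    _ ≤ ‖v‖ * sphereMass E := this
    _ = sphereMass E * ‖v‖ := mul_comm _ _

/-- **Gain bound on an energy shell**: if `|g| ≤ C` at all reflected velocities `v - 2(v·ω)ω`
(which have speed `|v|`), then `|(L⁺ g)(v)| ≤ |S^{d-1}| |v| C`. [folklore] -/
theorem abs_lorentzGainOp_le {g : E → ℝ} {v : E} {C : ℝ}
    (hC : ∀ ω : sphere (0 : E) 1, |g (v - (2 * ⟪v, (ω : E)⟫_ℝ) • (ω : E))| ≤ C) :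
    |lorentzGainOp g v| ≤ sphereMass E * ‖v‖ * C := by
  have h : ∀ᵐ ω : sphere (0 : E) 1 ∂KineticTheory.sphereMeasure,
      ‖max ⟪v, (ω : E)⟫_ℝ 0 * g (v - (2 * ⟪v, (ω : E)⟫_ℝ) • (ω : E))‖ ≤ ‖v‖ * C :=
    Eventually.of_forall fun ω => by
      rw [Real.norm_eq_abs, abs_mul]
      exact mul_le_mul (abs_max_inner_zero_le v ω) (hC ω) (abs_nonneg _) (norm_nonneg _)
  have := norm_integral_le_of_norm_le_const h
  rw [Real.norm_eq_abs] at this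
  calc |lorentzGainOp g v| ≤ ‖v‖ * C * sphereMass E := this
    _ = sphereMass E * ‖v‖ * C := by ring

/-- A continuous gain integrand is integrable on the sphere (compactness). [folklore] -/
theorem integrable_gainIntegrand_of_continuous {g : E → ℝ} (hg : Continuous g) (v : E) :
    Integrable (fun ω : sphere (0 : E) 1 =>
      max ⟪v, (ω : E)⟫_ℝ 0 * g (v - (2 * ⟪v, (ω : E)⟫_ℝ) • (ω : E))) KineticTheory.sphereMeasure := by
  refine Continuous.integrable_of_hasCompactSupport ?_ (HasCompactSupport.of_compactSpace _)
  exact (continuous_max_inner_zero.comp (Continuous.prodMk_right v)).mul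
    (hg.comp (continuous_reflect_velocity.comp (Continuous.prodMk_right v)))

/-- The loss frequency `v ↦ ν(v)` is continuous (parametric integral of a continuous kernel
over the compact sphere). [folklore] -/
theorem continuous_lorentzLossRate : Continuous (lorentzLossRate : E → ℝ) := by
  have h := continuous_parametric_integral_of_continuous
    (μ := (KineticTheory.sphereMeasure : Measure (sphere (0 : E) 1)))
    (f := fun (v : E) (ω : sphere (0 : E) 1) => max ⟪v, (ω : E)⟫_ℝ 0)
    continuous_max_inner_zero isCompact_univ
  unfold lorentzLossRate
  simpa only [Measure.restrict_univ] using h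

/-- **Parametric continuity of the gain operator**: if `h y w` is jointly continuous in
`(y, w)` and `v y` is continuous, then `y ↦ (L⁺ (h y))(v y)` is continuous (for a first
countable, locally compact parameter space). [folklore] -/
theorem continuous_lorentzGainOp_param {Y : Type*} [TopologicalSpace Y]
    [FirstCountableTopology Y] [LocallyCompactSpace Y] {h : Y → E → ℝ}
    (hh : Continuous fun p : Y × E => h p.1 p.2) {v : Y → E} (hv : Continuous v) :
    Continuous fun y => lorentzGainOp (h y) (v y) := by
  have hF : Continuous (Function.uncurry fun (y : Y) (ω : sphere (0 : E) 1) =>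
      max ⟪v y, (ω : E)⟫_ℝ 0 * h y (v y - (2 * ⟪v y, (ω : E)⟫_ℝ) • (ω : E))) := by
    have hvω : Continuous fun p : Y × sphere (0 : E) 1 => (v p.1, p.2) :=
      (hv.comp continuous_fst).prodMk continuous_snd
    refine (continuous_max_inner_zero.comp hvω).mul ?_
    exact hh.comp (continuous_fst.prodMk (continuous_reflect_velocity.comp hvω))
  have := continuous_parametric_integral_of_continuous
    (μ := (KineticTheory.sphereMeasure : Measure (sphere (0 : E) 1))) hF isCompact_univ
  unfold lorentzGainOp
  simpa only [Measure.restrict_univ] using this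

end SphereLemmas

/-! ## The terms of the collision series: continuity and factorial bounds -/

section Terms

variable {d : Type*} [Fintype d]

local notation "𝔼" => EuclideanSpace ℝ d

/-- **Joint continuity of the collision-series terms** in `(t, x, v)`, by induction: the
free-flight term is continuous, and `u_{n+1}` is a parametric interval integral (variable upper
limit) of a jointly continuous integrand built from `uₙ`, the continuous loss frequency and the
parametric gain operator. [folklore] -/
theorem continuous_lorentzSeriesTerm {σ : ℝ} {f₀ : 𝔼 → 𝔼 → ℝ}
    (hf₀ : Continuous (Function.uncurry f₀)) (n : ℕ) :
    Continuous fun p : ℝ × 𝔼 × 𝔼 =>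
      lorentzSeriesTerm (Literature.Analysis.FluidPDE.Euclidean.geometry d) σ f₀ n p.1 p.2.1 p.2.2 := by
  induction n with
  | zero =>
    simp only [lorentzSeriesTerm_zero, Literature.Analysis.FluidPDE.Euclidean.geometry_translate]
    refine Continuous.mul ?_ ?_
    · refine (Continuous.neg ?_).rexp
      exact (continuous_const.mul (continuous_lorentzLossRate.comp continuous_snd.snd)).mul
        continuous_fst
    · have harg : Continuous fun p : ℝ × 𝔼 × 𝔼 => (p.2.1 + (-p.1) • p.2.2, p.2.2) :=
        (continuous_snd.fst.add (continuous_fst.neg.smul continuous_snd.snd)).prodMk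
          continuous_snd.snd
      exact hf₀.comp harg
  | succ n ih =>
    simp only [lorentzSeriesTerm_succ, Literature.Analysis.FluidPDE.Euclidean.geometry_translate]
    -- the integrand, as a function of (parameters, integration variable)
    have hF : Continuous (Function.uncurry fun (p : ℝ × 𝔼 × 𝔼) (s : ℝ) =>
        exp (-(σ * lorentzLossRate p.2.2 * (p.1 - s))) *
          (σ * lorentzGainOp (lorentzSeriesTerm (Literature.Analysis.FluidPDE.Euclidean.geometry d) σ f₀ n s
            (p.2.1 + (s - p.1) • p.2.2)) p.2.2)) := by
      refine Continuous.mul ?_ (continuous_const.mul ?_)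
      · refine (Continuous.neg ?_).rexp
        exact (continuous_const.mul
          (continuous_lorentzLossRate.comp continuous_fst.snd.snd)).mul
            (continuous_fst.fst.sub continuous_snd)
      · -- parametric gain: parameters `q = (p, s)`, function `w ↦ uₙ(s, x + (s-t)v, w)`
        have hh : Continuous fun q : ((ℝ × 𝔼 × 𝔼) × ℝ) × 𝔼 =>
            lorentzSeriesTerm (Literature.Analysis.FluidPDE.Euclidean.geometry d) σ f₀ n q.1.2
              (q.1.1.2.1 + (q.1.2 - q.1.1.1) • q.1.1.2.2) q.2 := by
          have harg : Continuous fun q : ((ℝ × 𝔼 × 𝔼) × ℝ) × 𝔼 =>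
              (q.1.2, q.1.1.2.1 + (q.1.2 - q.1.1.1) • q.1.1.2.2, q.2) :=
            continuous_fst.snd.prodMk
              ((continuous_fst.fst.snd.fst.add
                ((continuous_fst.snd.sub continuous_fst.fst.fst).smul
                  continuous_fst.fst.snd.snd)).prodMk continuous_snd)
          exact ih.comp harg
        exact continuous_lorentzGainOp_param hh continuous_fst.snd.snd
    exact intervalIntegral.continuous_parametric_intervalIntegral_of_continuous hF continuous_fst

/-- Continuity of each term in the velocity-function slot `w ↦ uₙ(s, y, w)` jointly with all
parameters, in the form consumed by `continuous_lorentzGainOp_param`. [folklore] -/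
theorem continuous_lorentzSeriesTerm_comp {σ : ℝ} {f₀ : 𝔼 → 𝔼 → ℝ}
    (hf₀ : Continuous (Function.uncurry f₀)) (n : ℕ)
    {Y : Type*} [TopologicalSpace Y] {s : Y → ℝ} {y : Y → 𝔼} {w : Y → 𝔼} (hs : Continuous s)
    (hy : Continuous y) (hw : Continuous w) :
    Continuous fun q : Y => lorentzSeriesTerm (Literature.Analysis.FluidPDE.Euclidean.geometry d) σ f₀ n (s q) (y q) (w q) :=
  (continuous_lorentzSeriesTerm hf₀ n).comp (hs.prodMk (hy.prodMk hw))

/-- `termRate` only depends on the speed: it is invariant under the reflections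
`v ↦ v - 2(v·ω)ω`. [folklore] -/
theorem termRate_reflect (σ : ℝ) (v : 𝔼) (ω : sphere (0 : 𝔼) 1) :
    termRate σ (v - (2 * ⟪v, (ω : 𝔼)⟫_ℝ) • (ω : 𝔼)) = termRate σ v := by
  rw [termRate, termRate, Literature.Analysis.FunctionSpaces.norm_sub_two_mul_inner_smul]

/-- The damping exponent is dominated by the rate: `σ ν(v) |r| ≤ a(v) |r|`, whence
`e^{-σν(v) r} ≤ e^{a(v) T}` for `|r| ≤ T`. [folklore] -/
theorem exp_neg_lossRate_mul_le {σ : ℝ} (hσ : 0 ≤ σ) (v : 𝔼) {r T : ℝ} (hr : |r| ≤ T) :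
    exp (-(σ * lorentzLossRate v * r)) ≤ exp (termRate σ v * T) := by
  refine exp_le_exp.2 ?_
  have h1 : -(σ * lorentzLossRate v * r) ≤ σ * lorentzLossRate v * |r| := by
    have : 0 ≤ σ * lorentzLossRate v := mul_nonneg hσ (lorentzLossRate_nonneg v)
    nlinarith [neg_abs_le r]
  refine h1.trans ?_
  have h2 : σ * lorentzLossRate v ≤ termRate σ v := by
    rw [termRate, mul_assoc]
    exact mul_le_mul_of_nonneg_left (lorentzLossRate_le v) hσ
  exact mul_le_mul h2 hr (abs_nonneg r) (termRate_nonneg hσ v)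

/-- **Factorial bound on the collision-series terms**: for `σ ≥ 0`, `|f₀| ≤ M` and `|t| ≤ T`,
`|uₙ(t, x, v)| ≤ M e^{a(v)T} (a(v) e^{a(v)T})ⁿ |t|ⁿ / n!` with `a(v) = σ |S^{d-1}| |v|`
(each collision costs a factor `σ ∫(v·ω)₊ ≤ a(v)`, the jumps preserve the speed, damping
factors are `≤ e^{a(v)T}`, and the ordered time integrals give `|t|ⁿ/n!`). [folklore] -/
theorem abs_lorentzSeriesTerm_le {σ : ℝ} (hσ : 0 ≤ σ) {f₀ : 𝔼 → 𝔼 → ℝ} {M : ℝ}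
    (hM : ∀ x v, |f₀ x v| ≤ M) {T : ℝ} (n : ℕ) {t : ℝ} (ht : |t| ≤ T) (x v : 𝔼) :
    |lorentzSeriesTerm (Literature.Analysis.FluidPDE.Euclidean.geometry d) σ f₀ n t x v| ≤
      M * exp (termRate σ v * T) * (termRate σ v * exp (termRate σ v * T)) ^ n * |t| ^ n / n ! := by
  induction n generalizing t x v with
  | zero =>
    rw [lorentzSeriesTerm_zero, abs_mul, abs_of_pos (exp_pos _), pow_zero, pow_zero, mul_one,
      mul_one, Nat.factorial_zero, Nat.cast_one, div_one, mul_comm M]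
    exact mul_le_mul (exp_neg_lossRate_mul_le hσ v ht) (hM _ _) (abs_nonneg _) (exp_pos _).le
  | succ n ih =>
    rw [lorentzSeriesTerm_succ]
    -- abbreviations
    set a : ℝ := termRate σ v with ha
    set C : ℝ := a * exp (a * T) with hC
    have hT : 0 ≤ T := (abs_nonneg t).trans ht
    have ha0 : 0 ≤ a := termRate_nonneg hσ v
    have hC0 : 0 ≤ C := mul_nonneg ha0 (exp_pos _).le
    have hM0 : 0 ≤ M := (abs_nonneg _).trans (hM x v)
    -- pointwise bound of the integrand on `Ι 0 t`
    have hbound : ∀ s ∈ Ι (0 : ℝ) t,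
        |exp (-(σ * lorentzLossRate v * (t - s))) *
          (σ * lorentzGainOp (lorentzSeriesTerm (Literature.Analysis.FluidPDE.Euclidean.geometry d) σ f₀ n s
            ((Literature.Analysis.FluidPDE.Euclidean.geometry d).translate x ((s - t) • v))) v)| ≤
        M * exp (a * T) * C ^ (n + 1) / n ! * |s - 0| ^ n := by
      intro s hs
      have hs' : |s| ≤ |t| := by
        rcases mem_uIoc.1 hs with ⟨h1, h2⟩ | ⟨h1, h2⟩
        · rw [abs_of_nonneg h1.le]; exact h2.trans (le_abs_self t)
        · rw [abs_of_nonpos h2, abs_of_neg (h1.trans_le h2)]; linarith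
      have hsT : |s| ≤ T := hs'.trans ht
      have hts : |t - s| ≤ T := by
        refine le_trans ?_ ht
        rcases mem_uIoc.1 hs with ⟨h1, h2⟩ | ⟨h1, h2⟩
        · rw [abs_of_nonneg (by linarith), abs_of_nonneg (by linarith)]; linarith
        · rw [abs_of_nonpos (by linarith), abs_of_nonpos (h1.trans_le h2).le]; linarith
      -- the gain factor, via the induction hypothesis on the shell `|w| = |v|`
      have hgain : |lorentzGainOp (lorentzSeriesTerm (Literature.Analysis.FluidPDE.Euclidean.geometry d) σ f₀ n s
          ((Literature.Analysis.FluidPDE.Euclidean.geometry d).translate x ((s - t) • v))) v| ≤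
          sphereMass 𝔼 * ‖v‖ * (M * exp (a * T) * C ^ n * |s| ^ n / n !) := by
        refine abs_lorentzGainOp_le fun ω => ?_
        have := ih hsT ((Literature.Analysis.FluidPDE.Euclidean.geometry d).translate x ((s - t) • v))
          (v - (2 * ⟪v, (ω : 𝔼)⟫_ℝ) • (ω : 𝔼))
        rwa [termRate_reflect] at this
      rw [abs_mul, abs_of_pos (exp_pos _), abs_mul, abs_of_nonneg hσ, sub_zero]
      calc exp (-(σ * lorentzLossRate v * (t - s))) *
            (σ * |lorentzGainOp (lorentzSeriesTerm (Literature.Analysis.FluidPDE.Euclidean.geometry d) σ f₀ n s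
              ((Literature.Analysis.FluidPDE.Euclidean.geometry d).translate x ((s - t) • v))) v|)
          ≤ exp (a * T) * (σ * (sphereMass 𝔼 * ‖v‖ * (M * exp (a * T) * C ^ n * |s| ^ n / n !))) :=
            mul_le_mul (exp_neg_lossRate_mul_le hσ v hts) (mul_le_mul_of_nonneg_left hgain hσ)
              (mul_nonneg hσ (abs_nonneg _)) (exp_pos _).le
        _ = M * exp (a * T) * C ^ (n + 1) / n ! * |s| ^ n := by
            rw [hC, ha, termRate]; ring
    -- integrate the bound
    have hint : IntervalIntegrable (fun s : ℝ => M * exp (a * T) * C ^ (n + 1) / n ! * |s - 0| ^ n)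
        volume 0 t :=
      (continuous_const.mul ((continuous_id.sub continuous_const).abs.pow n)).intervalIntegrable _ _
    have h1 := intervalIntegral.norm_integral_le_abs_of_norm_le
      ((ae_restrict_iff' measurableSet_uIoc).2 (Eventually.of_forall fun s hs => by
        rw [Real.norm_eq_abs]; exact hbound s hs)) hint
    rw [Real.norm_eq_abs] at h1
    refine h1.trans (le_of_eq ?_)
    rw [intervalIntegral.integral_const_mul, abs_mul,
      intervalIntegral.abs_integral_eq_abs_integral_uIoc, integral_pow_abs_sub_uIoc, sub_zero,
      abs_of_nonneg (by positivity), abs_of_nonneg (by positivity), Nat.factorial_succ,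
      Nat.cast_mul, Nat.cast_succ]
    field_simp

end Terms

/-! ## Summability and continuity of the collision series -/

section Sum

variable {d : Type*} [Fintype d]

local notation "𝔼" => EuclideanSpace ℝ d

/-- The dominating sequence `M e^{aT} (a e^{aT})ⁿ Tⁿ / n!` of the factorial bound is summable
(exponential series). [folklore] -/
theorem summable_termBound (M a T : ℝ) :
    Summable fun n : ℕ => M * exp (a * T) * (a * exp (a * T)) ^ n * T ^ n / n ! := by
  have := (Real.summable_pow_div_factorial (a * exp (a * T) * T)).mul_left (M * exp (a * T))
  refine this.congr fun n => ?_
  rw [mul_pow]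
  ring

/-- Monotonicity of the dominating sequence in the rate `a` and the time `|t| ≤ T`. [folklore] -/
theorem termBound_mono {M a A t T : ℝ} (hM : 0 ≤ M) (ha : 0 ≤ a) (haA : a ≤ A) (hT : 0 ≤ T)
    (ht : |t| ≤ T) (n : ℕ) :
    M * exp (a * T) * (a * exp (a * T)) ^ n * |t| ^ n / n ! ≤
      M * exp (A * T) * (A * exp (A * T)) ^ n * T ^ n / n ! := by
  have h1 : exp (a * T) ≤ exp (A * T) := exp_le_exp.2 (mul_le_mul_of_nonneg_right haA hT)
  have h2 : a * exp (a * T) ≤ A * exp (A * T) := mul_le_mul haA h1 (exp_pos _).le (ha.trans haA)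
  have h3 : (a * exp (a * T)) ^ n ≤ (A * exp (A * T)) ^ n :=
    pow_le_pow_left₀ (mul_nonneg ha (exp_pos _).le) h2 n
  have h4 : |t| ^ n ≤ T ^ n := pow_le_pow_left₀ (abs_nonneg t) ht n
  have hA : 0 ≤ A := ha.trans haA
  have hXn : 0 ≤ (a * exp (a * T)) ^ n := pow_nonneg (mul_nonneg ha (exp_pos _).le) n
  have hYn : 0 ≤ (A * exp (A * T)) ^ n := pow_nonneg (mul_nonneg hA (exp_pos _).le) n
  refine div_le_div_of_nonneg_right ?_ (by positivity)
  exact mul_le_mul (mul_le_mul (mul_le_mul_of_nonneg_left h1 hM) h3 hXn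
    (mul_nonneg hM (exp_pos _).le)) h4 (pow_nonneg (abs_nonneg t) n)
    (mul_nonneg (mul_nonneg hM (exp_pos _).le) hYn)

/-- **Absolute summability of the collision series** at every `(t, x, v)` for bounded data and
`σ ≥ 0` (comparison with the exponential series via the factorial bound). [folklore] -/
theorem summable_abs_lorentzSeriesTerm {σ : ℝ} {f₀ : 𝔼 → 𝔼 → ℝ} (hσ : 0 ≤ σ) {M : ℝ} (hM : ∀ x v, |f₀ x v| ≤ M)
    (t : ℝ) (x v : 𝔼) :
    Summable fun n => |lorentzSeriesTerm (Literature.Analysis.FluidPDE.Euclidean.geometry d) σ f₀ n t x v| :=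
  Summable.of_nonneg_of_le (fun _ => abs_nonneg _)
    (fun n => abs_lorentzSeriesTerm_le hσ hM n le_rfl x v) (summable_termBound M (termRate σ v) |t|)

/-- Summability of the collision series at every `(t, x, v)`. [folklore] -/
theorem summable_lorentzSeriesTerm {σ : ℝ} {f₀ : 𝔼 → 𝔼 → ℝ} (hσ : 0 ≤ σ) {M : ℝ} (hM : ∀ x v, |f₀ x v| ≤ M)
    (t : ℝ) (x v : 𝔼) :
    Summable fun n => lorentzSeriesTerm (Literature.Analysis.FluidPDE.Euclidean.geometry d) σ f₀ n t x v :=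
  (summable_abs_lorentzSeriesTerm hσ hM t x v).of_abs

/-- The collision series converges to `lorentzSeriesSolution`. [folklore] -/
theorem hasSum_lorentzSeriesTerm {σ : ℝ} {f₀ : 𝔼 → 𝔼 → ℝ} (hσ : 0 ≤ σ) {M : ℝ} (hM : ∀ x v, |f₀ x v| ≤ M)
    (t : ℝ) (x v : 𝔼) :
    HasSum (fun n => lorentzSeriesTerm (Literature.Analysis.FluidPDE.Euclidean.geometry d) σ f₀ n t x v)
      (lorentzSeriesSolution (Literature.Analysis.FluidPDE.Euclidean.geometry d) σ f₀ t x v) :=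
  (summable_lorentzSeriesTerm hσ hM t x v).hasSum

/-- **Joint continuity of the collision series** in `(t, x, v)`: the convergence is uniform on
the open sets `{|t| < T} × ℝ^d × {|v| < V}`, on which the factorial bound is uniform.
[folklore] -/
theorem continuous_lorentzSeriesSolution {σ : ℝ} {f₀ : 𝔼 → 𝔼 → ℝ} (hσ : 0 ≤ σ) {M : ℝ} (hM : ∀ x v, |f₀ x v| ≤ M)
    (hf₀ : Continuous (Function.uncurry f₀)) :
    Continuous fun p : ℝ × 𝔼 × 𝔼 =>
      lorentzSeriesSolution (Literature.Analysis.FluidPDE.Euclidean.geometry d) σ f₀ p.1 p.2.1 p.2.2 := by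
  refine continuous_iff_continuousAt.2 fun p => ?_
  set T : ℝ := |p.1| + 1 with hT
  set V : ℝ := ‖p.2.2‖ + 1 with hV
  set S : Set (ℝ × 𝔼 × 𝔼) := {q | |q.1| < T ∧ ‖q.2.2‖ < V} with hS
  have hSo : IsOpen S :=
    (isOpen_lt (continuous_abs.comp continuous_fst) continuous_const).inter
      (isOpen_lt (continuous_norm.comp continuous_snd.snd) continuous_const)
  have hp : p ∈ S := ⟨lt_add_one _, lt_add_one _⟩
  refine ContinuousOn.continuousAt ?_ (hSo.mem_nhds hp)
  have hM0 : 0 ≤ M := (abs_nonneg _).trans (hM p.2.1 p.2.2)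
  have hT0 : 0 ≤ T := by positivity
  set A : ℝ := σ * sphereMass 𝔼 * V with hA
  refine continuousOn_tsum (fun n => (continuous_lorentzSeriesTerm hf₀ n).continuousOn)
    (summable_termBound M A T) fun n q hq => ?_
  rw [Real.norm_eq_abs]
  refine (abs_lorentzSeriesTerm_le hσ hM n hq.1.le q.2.1 q.2.2).trans ?_
  have haA : termRate σ q.2.2 ≤ A :=
    mul_le_mul_of_nonneg_left hq.2.le (mul_nonneg hσ sphereMass_nonneg)
  exact termBound_mono hM0 (termRate_nonneg hσ _) haA hT0 hq.1.le n

/-- Continuity of the collision series in the velocity slot, jointly with parameters. [folklore] -/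
theorem continuous_lorentzSeriesSolution_comp {σ : ℝ} {f₀ : 𝔼 → 𝔼 → ℝ} (hσ : 0 ≤ σ) {M : ℝ} (hM : ∀ x v, |f₀ x v| ≤ M)
    (hf₀ : Continuous (Function.uncurry f₀)) {Y : Type*} [TopologicalSpace Y] {s : Y → ℝ}
    {y : Y → 𝔼} {w : Y → 𝔼} (hs : Continuous s) (hy : Continuous y) (hw : Continuous w) :
    Continuous fun q : Y =>
      lorentzSeriesSolution (Literature.Analysis.FluidPDE.Euclidean.geometry d) σ f₀ (s q) (y q) (w q) :=
  (continuous_lorentzSeriesSolution hσ hM hf₀).comp (hs.prodMk (hy.prodMk hw))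

end Sum

/-! ## The summed recursion: the gain/loss Duhamel formula for the series -/

section GainLoss

variable {d : Type*} [Fintype d]

local notation "𝔼" => EuclideanSpace ℝ d

/-- The gain operator along a characteristic, `s ↦ (L⁺ g(s, x + (s - t)v, ·))(v)`, is
continuous for jointly continuous `g`. [folklore] -/
theorem continuous_lorentzGainOp_along {g : ℝ → 𝔼 → 𝔼 → ℝ}
    (hg : Continuous fun p : ℝ × 𝔼 × 𝔼 => g p.1 p.2.1 p.2.2) (t : ℝ) (x v : 𝔼) :
    Continuous fun s : ℝ => lorentzGainOp (g s (x + (s - t) • v)) v := by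
  have harg : Continuous fun q : ℝ × 𝔼 => (q.1, x + (q.1 - t) • v, q.2) :=
    continuous_fst.prodMk ((continuous_const.add ((continuous_fst.sub continuous_const).smul
      continuous_const)).prodMk continuous_snd)
  exact continuous_lorentzGainOp_param (h := fun s w => g s (x + (s - t) • v) w) (hg.comp harg)
    continuous_const

/-- **The gain operator commutes with the collision series**:
`∑ₙ (L⁺ uₙ(s, y, ·))(v) = (L⁺ f(s, y, ·))(v)` (dominated convergence on the sphere, the
factorial bound being uniform on the energy shell `|w| = |v|`). [folklore] -/
theorem hasSum_lorentzGainOp_lorentzSeriesTerm {σ : ℝ} {f₀ : 𝔼 → 𝔼 → ℝ} (hσ : 0 ≤ σ) {M : ℝ} (hM : ∀ x v, |f₀ x v| ≤ M)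
    (hf₀ : Continuous (Function.uncurry f₀)) (s : ℝ) (y v : 𝔼) :
    HasSum (fun n => lorentzGainOp (lorentzSeriesTerm (Literature.Analysis.FluidPDE.Euclidean.geometry d) σ f₀ n s y) v)
      (lorentzGainOp (lorentzSeriesSolution (Literature.Analysis.FluidPDE.Euclidean.geometry d) σ f₀ s y) v) := by
  unfold lorentzGainOp
  set a : ℝ := termRate σ v with ha
  refine hasSum_integral_of_dominated_convergence
    (fun n _ => ‖v‖ * (M * exp (a * |s|) * (a * exp (a * |s|)) ^ n * |s| ^ n / n !))
    (fun n => ?_) (fun n => Eventually.of_forall fun ω => ?_)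
    (Eventually.of_forall fun _ => (summable_termBound M a |s|).mul_left ‖v‖) (integrable_const _)
    (Eventually.of_forall fun ω => ?_)
  · exact (integrable_gainIntegrand_of_continuous (continuous_lorentzSeriesTerm_comp hf₀ n
      continuous_const continuous_const continuous_id) v).aestronglyMeasurable
  · rw [Real.norm_eq_abs, abs_mul]
    refine mul_le_mul (abs_max_inner_zero_le v ω) ?_ (abs_nonneg _) (norm_nonneg _)
    have := abs_lorentzSeriesTerm_le hσ hM n (le_refl |s|) y
      (v - (2 * ⟪v, (ω : 𝔼)⟫_ℝ) • (ω : 𝔼))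
    rwa [termRate_reflect] at this
  · exact (hasSum_lorentzSeriesTerm hσ hM s y _).mul_left _

/-- **The summed recursion (gain/loss Duhamel formula for the collision series).** For bounded
continuous data and `σ ≥ 0`,
`f(t, x, v) = e^{-σν(v)t} f₀(x - tv, v) + ∫₀ᵗ e^{-σν(v)(t-s)} σ (L⁺ f(s, x - (t-s)v, ·))(v) ds`:
split off the free-flight term and exchange the sum with the time integral (dominated
convergence, factorial bound) and with the gain operator
(`hasSum_lorentzGainOp_lorentzSeriesTerm`). [folklore] -/
theorem lorentzSeriesSolution_eq_gainLoss {σ : ℝ} {f₀ : 𝔼 → 𝔼 → ℝ} (hσ : 0 ≤ σ) {M : ℝ} (hM : ∀ x v, |f₀ x v| ≤ M)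
    (hf₀ : Continuous (Function.uncurry f₀)) (t : ℝ) (x v : 𝔼) :
    lorentzSeriesSolution (Literature.Analysis.FluidPDE.Euclidean.geometry d) σ f₀ t x v =
      exp (-(σ * lorentzLossRate v * t)) * f₀ (x + (-t) • v) v +
      ∫ s in (0 : ℝ)..t, exp (-(σ * lorentzLossRate v * (t - s))) *
        (σ * lorentzGainOp (lorentzSeriesSolution (Literature.Analysis.FluidPDE.Euclidean.geometry d) σ f₀ s
          (x + (s - t) • v)) v) := by
  have hsum := hasSum_lorentzSeriesTerm hσ hM t x v
  have h0 := (hasSum_nat_add_iff' 1).2 hsum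
  rw [Finset.sum_range_one, lorentzSeriesTerm_zero, Literature.Analysis.FluidPDE.Euclidean.geometry_translate] at h0
  -- the shifted series sums to the integral
  set a : ℝ := termRate σ v with ha
  set T : ℝ := |t| with hT
  have hM0 : 0 ≤ M := (abs_nonneg _).trans (hM x v)
  have ha0 : 0 ≤ a := termRate_nonneg hσ v
  have hint : HasSum (fun n => lorentzSeriesTerm (Literature.Analysis.FluidPDE.Euclidean.geometry d) σ f₀ (n + 1) t x v)
      (∫ s in (0 : ℝ)..t, exp (-(σ * lorentzLossRate v * (t - s))) *
        (σ * lorentzGainOp (lorentzSeriesSolution (Literature.Analysis.FluidPDE.Euclidean.geometry d) σ f₀ s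
          (x + (s - t) • v)) v)) := by
    simp only [lorentzSeriesTerm_succ, Literature.Analysis.FluidPDE.Euclidean.geometry_translate]
    refine intervalIntegral.hasSum_integral_of_dominated_convergence
      (fun n _ => a * exp (a * T) * (M * exp (a * T) * (a * exp (a * T)) ^ n * T ^ n / n !))
      (fun n => ?_) (fun n => Eventually.of_forall fun s hs => ?_)
      (Eventually.of_forall fun s _ => (summable_termBound M a T).mul_left _)
      intervalIntegrable_const (Eventually.of_forall fun s _ => ?_)
    · -- measurability: the integrand is continuous in `s`
      refine Continuous.aestronglyMeasurable ?_
      refine Continuous.mul ((Continuous.neg ?_).rexp) (continuous_const.mul ?_)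
      · exact continuous_const.mul (continuous_const.sub continuous_id)
      · exact continuous_lorentzGainOp_along (continuous_lorentzSeriesTerm hf₀ n) t x v
    · -- the factorial bound on `Ι 0 t`
      have hs' : |s| ≤ T := by
        rcases mem_uIoc.1 hs with ⟨h1, h2⟩ | ⟨h1, h2⟩
        · rw [abs_of_nonneg h1.le]; exact h2.trans (le_abs_self t)
        · rw [hT, abs_of_nonpos h2, abs_of_neg (h1.trans_le h2)]; linarith
      have hts : |t - s| ≤ T := by
        rcases mem_uIoc.1 hs with ⟨h1, h2⟩ | ⟨h1, h2⟩
        · rw [hT, abs_of_nonneg (by linarith), abs_of_nonneg (by linarith)]; linarith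
        · rw [hT, abs_of_nonpos (by linarith), abs_of_nonpos (h1.trans_le h2).le]; linarith
      have hgain : |lorentzGainOp (lorentzSeriesTerm (Literature.Analysis.FluidPDE.Euclidean.geometry d) σ f₀ n s
          (x + (s - t) • v)) v| ≤ sphereMass 𝔼 * ‖v‖ * (M * exp (a * T) * (a * exp (a * T)) ^ n *
            T ^ n / n !) := by
        refine abs_lorentzGainOp_le fun ω => ?_
        have := abs_lorentzSeriesTerm_le hσ hM n hs' (x + (s - t) • v)
          (v - (2 * ⟪v, (ω : 𝔼)⟫_ℝ) • (ω : 𝔼))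
        rw [termRate_reflect] at this
        exact this.trans (termBound_mono hM0 ha0 le_rfl (abs_nonneg t) hs' n)
      rw [Real.norm_eq_abs, abs_mul, abs_of_pos (exp_pos _), abs_mul, abs_of_nonneg hσ]
      calc exp (-(σ * lorentzLossRate v * (t - s))) *
            (σ * |lorentzGainOp (lorentzSeriesTerm (Literature.Analysis.FluidPDE.Euclidean.geometry d) σ f₀ n s
              (x + (s - t) • v)) v|)
          ≤ exp (a * T) * (σ * (sphereMass 𝔼 * ‖v‖ * (M * exp (a * T) * (a * exp (a * T)) ^ n *
              T ^ n / n !))) :=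
            mul_le_mul (exp_neg_lossRate_mul_le hσ v hts) (mul_le_mul_of_nonneg_left hgain hσ)
              (mul_nonneg hσ (abs_nonneg _)) (exp_pos _).le
        _ = a * exp (a * T) * (M * exp (a * T) * (a * exp (a * T)) ^ n * T ^ n / n !) := by
            rw [ha, termRate]; ring
    · exact ((hasSum_lorentzGainOp_lorentzSeriesTerm hσ hM hf₀ s (x + (s - t) • v) v).mul_left
        σ).mul_left _
  have := h0.unique hint
  linarith

/-- **The gain/loss formula along characteristics**: with `g(s) = f(s, x + sv, v)` and
`H(s) = σ (L⁺ f(s, x + sv, ·))(v)`,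
`g(t) = e^{-σν(v)t} f₀(x, v) + ∫₀ᵗ e^{-σν(v)(t-s)} H(s) ds`. [folklore] -/
theorem alongFlow_lorentzSeriesSolution {σ : ℝ} {f₀ : 𝔼 → 𝔼 → ℝ} (hσ : 0 ≤ σ) {M : ℝ} (hM : ∀ x v, |f₀ x v| ≤ M)
    (hf₀ : Continuous (Function.uncurry f₀)) (t : ℝ) (x v : 𝔼) :
    Literature.Analysis.FluidPDE.alongFlow (Literature.Analysis.FluidPDE.Euclidean.geometry d) (lorentzSeriesSolution (Literature.Analysis.FluidPDE.Euclidean.geometry d) σ f₀) t x v =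
      exp (-(σ * lorentzLossRate v * t)) * f₀ x v +
      ∫ s in (0 : ℝ)..t, exp (-(σ * lorentzLossRate v * (t - s))) *
        (σ * lorentzGainOp (lorentzSeriesSolution (Literature.Analysis.FluidPDE.Euclidean.geometry d) σ f₀ s (x + s • v)) v) := by
  rw [Literature.Analysis.FluidPDE.alongFlow, Literature.Analysis.FluidPDE.Euclidean.geometry_translate, lorentzSeriesSolution_eq_gainLoss hσ hM hf₀]
  have h1 : x + t • v + (-t) • v = x := by rw [add_assoc, ← add_smul, add_neg_cancel, zero_smul,
    add_zero]
  have h2 : ∀ s : ℝ, x + t • v + (s - t) • v = x + s • v := fun s => by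
    rw [add_assoc, ← add_smul, add_sub_cancel]
  simp_rw [h1, h2]

end GainLoss

/-! ## From the gain/loss formula to Duhamel's formula: the series is a mild solution -/

section Duhamel

variable {d : Type*} [Fintype d]

local notation "𝔼" => EuclideanSpace ℝ d

/-- **Differentiability along characteristics**: `g(s) = f(s, x + sv, v)` is differentiable with
`g'(t) = σ (L⁺ f(t, x + tv, ·))(v) - σ ν(v) g(t)` (write `g(t) = e^{-λt}(f₀ + ∫₀ᵗ e^{λs} H(s) ds)`
and differentiate the continuous primitive). [folklore] -/
theorem hasDerivAt_alongFlow_lorentzSeriesSolution {σ : ℝ} {f₀ : 𝔼 → 𝔼 → ℝ} (hσ : 0 ≤ σ) {M : ℝ} (hM : ∀ x v, |f₀ x v| ≤ M)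
    (hf₀ : Continuous (Function.uncurry f₀)) (x v : 𝔼) (t : ℝ) :
    HasDerivAt (fun s => Literature.Analysis.FluidPDE.alongFlow (Literature.Analysis.FluidPDE.Euclidean.geometry d)
        (lorentzSeriesSolution (Literature.Analysis.FluidPDE.Euclidean.geometry d) σ f₀) s x v)
      (σ * lorentzGainOp (lorentzSeriesSolution (Literature.Analysis.FluidPDE.Euclidean.geometry d) σ f₀ t (x + t • v)) v -
        σ * lorentzLossRate v * Literature.Analysis.FluidPDE.alongFlow (Literature.Analysis.FluidPDE.Euclidean.geometry d)
          (lorentzSeriesSolution (Literature.Analysis.FluidPDE.Euclidean.geometry d) σ f₀) t x v) t := by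
  set lam : ℝ := σ * lorentzLossRate v with hlam
  set H : ℝ → ℝ := fun s =>
    σ * lorentzGainOp (lorentzSeriesSolution (Literature.Analysis.FluidPDE.Euclidean.geometry d) σ f₀ s (x + s • v)) v with hH
  have hHc : Continuous H := by
    refine continuous_const.mul ?_
    have := continuous_lorentzGainOp_along (continuous_lorentzSeriesSolution hσ hM hf₀) 0 x v
    simpa only [sub_zero] using this
  set K : ℝ → ℝ := fun s => f₀ x v + ∫ r in (0 : ℝ)..s, exp (lam * r) * H r with hK
  -- rewrite `g` as `e^{-λ s} K(s)`
  have hg : (fun s => Literature.Analysis.FluidPDE.alongFlow (Literature.Analysis.FluidPDE.Euclidean.geometry d)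
      (lorentzSeriesSolution (Literature.Analysis.FluidPDE.Euclidean.geometry d) σ f₀) s x v) =
      fun s => exp (-(lam * s)) * K s := by
    funext s
    rw [alongFlow_lorentzSeriesSolution hσ hM hf₀ s x v, hK]
    simp only
    rw [mul_add, ← intervalIntegral.integral_const_mul]
    congr 1
    refine intervalIntegral.integral_congr fun r _ => ?_
    simp only [hH]
    rw [hlam, ← mul_assoc (rexp _) (rexp _), ← Real.exp_add]
    congr 2
    ring
  have hKd : HasDerivAt K (exp (lam * t) * H t) t := by
    have hc : Continuous fun r => exp (lam * r) * H r :=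
      (continuous_const.mul continuous_id).rexp.mul hHc
    rw [hK]
    exact (hc.integral_hasStrictDerivAt 0 t).hasDerivAt.const_add (f₀ x v)
  have hEd : HasDerivAt (fun s => exp (-(lam * s))) (-lam * exp (-(lam * t))) t := by
    have h1 : HasDerivAt (fun s : ℝ => -(lam * s)) (-lam) t := by
      have h := (hasDerivAt_id t).const_mul (-lam)
      simp only [id_eq, mul_one, neg_mul] at h
      exact h
    have h2 := h1.exp
    convert h2 using 1
    ring
  rw [hg]
  refine (hEd.mul hKd).congr_deriv ?_
  rw [show Literature.Analysis.FluidPDE.alongFlow (Literature.Analysis.FluidPDE.Euclidean.geometry d) (lorentzSeriesSolution (Literature.Analysis.FluidPDE.Euclidean.geometry d) σ f₀) t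
      x v = exp (-(lam * t)) * K t from congrFun hg t]
  simp only [hH]
  have hee : exp (-(lam * t)) * exp (lam * t) = 1 := by rw [← Real.exp_add]; simp
  calc -lam * exp (-(lam * t)) * K t + exp (-(lam * t)) * (exp (lam * t) *
        (σ * lorentzGainOp (lorentzSeriesSolution (Literature.Analysis.FluidPDE.Euclidean.geometry d) σ f₀ t (x + t • v)) v))
      = -lam * exp (-(lam * t)) * K t + (exp (-(lam * t)) * exp (lam * t)) *
        (σ * lorentzGainOp (lorentzSeriesSolution (Literature.Analysis.FluidPDE.Euclidean.geometry d) σ f₀ t (x + t • v)) v) := by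
        ring
    _ = σ * lorentzGainOp (lorentzSeriesSolution (Literature.Analysis.FluidPDE.Euclidean.geometry d) σ f₀ t (x + t • v)) v -
        lam * (exp (-(lam * t)) * K t) := by rw [hee]; ring

/-- The collision term along a characteristic of the series is the continuous function
`τ ↦ σ (L⁺ f(τ, x + τv, ·))(v) - σ ν(v) f(τ, x + τv, v)` (gain/loss splitting, the gain
integrand being continuous on the sphere). [folklore] -/
theorem alongFlow_lorentzCollisionTerm_lorentzSeriesSolution {σ : ℝ} {f₀ : 𝔼 → 𝔼 → ℝ} (hσ : 0 ≤ σ) {M : ℝ}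
    (hM : ∀ x v, |f₀ x v| ≤ M) (hf₀ : Continuous (Function.uncurry f₀)) (x v : 𝔼) (τ : ℝ) :
    Literature.Analysis.FluidPDE.alongFlow (Literature.Analysis.FluidPDE.Euclidean.geometry d) (Literature.Analysis.FunctionSpaces.lorentzCollisionTerm σ
        (lorentzSeriesSolution (Literature.Analysis.FluidPDE.Euclidean.geometry d) σ f₀)) τ x v =
      σ * lorentzGainOp (lorentzSeriesSolution (Literature.Analysis.FluidPDE.Euclidean.geometry d) σ f₀ τ (x + τ • v)) v -
        σ * lorentzLossRate v * Literature.Analysis.FluidPDE.alongFlow (Literature.Analysis.FluidPDE.Euclidean.geometry d)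
          (lorentzSeriesSolution (Literature.Analysis.FluidPDE.Euclidean.geometry d) σ f₀) τ x v := by
  simp only [Literature.Analysis.FluidPDE.alongFlow, Literature.Analysis.FunctionSpaces.lorentzCollisionTerm, Literature.Analysis.FluidPDE.Euclidean.geometry_translate, Pi.smul_apply,
    smul_eq_mul]
  rw [lorentzCollisionOp_eq_gain_sub_loss _ _ (integrable_gainIntegrand_of_continuous
    (continuous_lorentzSeriesSolution_comp hσ hM hf₀ continuous_const continuous_const
      continuous_id) v)]
  ring

/-- **Duhamel's formula for the collision series**:
`f♯(t, x, v) = f(0, x, v) + ∫₀ᵗ (σ L f)♯(τ, x, v) dτ` for every `t` (fundamental theorem of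
calculus applied to `hasDerivAt_alongFlow_lorentzSeriesSolution`). [folklore] -/
theorem lorentzSeriesSolution_duhamel {σ : ℝ} {f₀ : 𝔼 → 𝔼 → ℝ} (hσ : 0 ≤ σ) {M : ℝ} (hM : ∀ x v, |f₀ x v| ≤ M)
    (hf₀ : Continuous (Function.uncurry f₀)) (x v : 𝔼) (t : ℝ) :
    Literature.Analysis.FluidPDE.alongFlow (Literature.Analysis.FluidPDE.Euclidean.geometry d) (lorentzSeriesSolution (Literature.Analysis.FluidPDE.Euclidean.geometry d) σ f₀) t x v =
      lorentzSeriesSolution (Literature.Analysis.FluidPDE.Euclidean.geometry d) σ f₀ 0 x v +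
      ∫ τ in (0 : ℝ)..t, Literature.Analysis.FluidPDE.alongFlow (Literature.Analysis.FluidPDE.Euclidean.geometry d) (Literature.Analysis.FunctionSpaces.lorentzCollisionTerm σ
        (lorentzSeriesSolution (Literature.Analysis.FluidPDE.Euclidean.geometry d) σ f₀)) τ x v := by
  have hderiv := fun τ (_ : τ ∈ uIcc 0 t) =>
    hasDerivAt_alongFlow_lorentzSeriesSolution hσ hM hf₀ x v τ
  have hcont : Continuous fun τ =>
      σ * lorentzGainOp (lorentzSeriesSolution (Literature.Analysis.FluidPDE.Euclidean.geometry d) σ f₀ τ (x + τ • v)) v -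
        σ * lorentzLossRate v * Literature.Analysis.FluidPDE.alongFlow (Literature.Analysis.FluidPDE.Euclidean.geometry d)
          (lorentzSeriesSolution (Literature.Analysis.FluidPDE.Euclidean.geometry d) σ f₀) τ x v := by
    refine (continuous_const.mul ?_).sub (continuous_const.mul ?_)
    · have := continuous_lorentzGainOp_along (continuous_lorentzSeriesSolution hσ hM hf₀) 0 x v
      simpa only [sub_zero] using this
    · simp only [Literature.Analysis.FluidPDE.alongFlow, Literature.Analysis.FluidPDE.Euclidean.geometry_translate]
      exact continuous_lorentzSeriesSolution_comp hσ hM hf₀ continuous_id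
        (continuous_const.add (continuous_id.smul continuous_const)) continuous_const
  have hftc := intervalIntegral.integral_eq_sub_of_hasDerivAt hderiv (hcont.intervalIntegrable _ _)
  simp_rw [alongFlow_lorentzCollisionTerm_lorentzSeriesSolution hσ hM hf₀ x v]
  rw [hftc, Literature.Analysis.FluidPDE.alongFlow_zero]
  ring

/-- **F1 discharged**: the collision series is, for every `T ≥ 0`, a mild solution on `[0, T]`
of the linear Lorentz–Boltzmann equation on `ℝ^d` (`Kinetic.lorentzSeries_isMildSolution`).
[cite: Spohn1978, §3 and Thm 3, (4.2)] -/
theorem lorentzSeries_isMildSolution_holds : lorentzSeries_isMildSolution (d := d) := by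
  intro σ hσ f₀ hf₀ hf₀0 hf₀b T _hT
  obtain ⟨C, hC⟩ := hf₀b
  have hM : ∀ x v, |Function.curry f₀ x v| ≤ C := fun x v => by
    rw [Function.curry_apply, abs_of_nonneg (hf₀0 _)]
    exact hC _
  have hf₀c : Continuous (Function.uncurry (Function.curry f₀)) := by
    rwa [Function.uncurry_curry]
  exact
    { nonneg := fun t ht x v =>
        lorentzSeriesSolution_nonneg _ hσ (fun x v => hf₀0 (x, v)) ht.1 x v
      intervalIntegrable := fun x v t _ => by
        have hcont : Continuous fun τ =>
            σ * lorentzGainOp (lorentzSeriesSolution (Literature.Analysis.FluidPDE.Euclidean.geometry d) σ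
              (Function.curry f₀) τ (x + τ • v)) v -
            σ * lorentzLossRate v * Literature.Analysis.FluidPDE.alongFlow (Literature.Analysis.FluidPDE.Euclidean.geometry d)
              (lorentzSeriesSolution (Literature.Analysis.FluidPDE.Euclidean.geometry d) σ (Function.curry f₀)) τ x v := by
          refine (continuous_const.mul ?_).sub (continuous_const.mul ?_)
          · have := continuous_lorentzGainOp_along
              (continuous_lorentzSeriesSolution hσ hM hf₀c) 0 x v
            simpa only [sub_zero] using this
          · simp only [Literature.Analysis.FluidPDE.alongFlow, Literature.Analysis.FluidPDE.Euclidean.geometry_translate]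
            exact continuous_lorentzSeriesSolution_comp hσ hM hf₀c continuous_id
              (continuous_const.add (continuous_id.smul continuous_const)) continuous_const
        have heq : (fun τ => Literature.Analysis.FluidPDE.alongFlow (Literature.Analysis.FluidPDE.Euclidean.geometry d) (Literature.Analysis.FunctionSpaces.lorentzCollisionTerm σ
            (lorentzSeriesSolution (Literature.Analysis.FluidPDE.Euclidean.geometry d) σ (Function.curry f₀))) τ x v) =
            fun τ => σ * lorentzGainOp (lorentzSeriesSolution (Literature.Analysis.FluidPDE.Euclidean.geometry d) σ
              (Function.curry f₀) τ (x + τ • v)) v -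
            σ * lorentzLossRate v * Literature.Analysis.FluidPDE.alongFlow (Literature.Analysis.FluidPDE.Euclidean.geometry d)
              (lorentzSeriesSolution (Literature.Analysis.FluidPDE.Euclidean.geometry d) σ (Function.curry f₀)) τ x v :=
          funext fun τ => alongFlow_lorentzCollisionTerm_lorentzSeriesSolution hσ hM hf₀c x v τ
        rw [heq]
        exact hcont.intervalIntegrable 0 t
      duhamel := fun x v t _ => lorentzSeriesSolution_duhamel hσ hM hf₀c x v t }

end Duhamel

end Kinetic

end

end Literature.MathematicalPhysics.KineticTheory
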